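import Literature.Computability.FineGrained.SchoeningCoinScan
import HarnessLib

/-!
# Schöning's random-walk algorithm for `k`-SAT, machine IV: one step, one restart

Topic `Literature/Computability/FineGrained`; machine half of the line `SchoeningCoin*` towards the
named fact `Literature.Computability.FineGrained.schoening` (Schöning, FOCS 1999, Theorem),
continuing `SchoeningCoinRoutines.lean` and `SchoeningCoinScan.lean`. Here the routines are
assembled into one step of the walk (`step`: scan; on success raise `done`, otherwise read `d`
coins and flip — `SchoeningCoin.stepL`) and one restart (`restartP`: clear the assignment,
`initPass`, lay the step counter, run the steps — `SchoeningCoin.restart`), each with a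
specification against the coin-string functions of `SchoeningCoinAlgorithm.lean` (through
`walkS`, the walk returning its final literal list as well) and an explicit polynomial budget
(`stepCost`, `restartCost`).

## References

* U. Schöning, *A probabilistic algorithm for k-SAT and constraint satisfaction problems*, Proc.
  40th FOCS (1999) 410–414 (the algorithm) [key `SchoeningFOCS1999`].
* T. Nipkow, G. Klein, *Concrete Semantics with Isabelle/HOL*, Springer 2014, Ch. 7.
-/

namespace Literature.Computability.FineGrained.SchoeningCoin

open _root_.Computability Complexity Complexity.ACom IPRenameM Sparsifier

variable {k : ℕ}

/-! ### The walk with its final literal list -/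

/-- The walk of `SchoeningCoinAlgorithm.lean` returning also the final literal list (the content
of the assignment register when the machine stops stepping). [folklore] -/
def walkS (φ : KCNF k) (d : ℕ) : ℕ → Asg → List Bool → Asg × Bool × List Bool
  | 0, L, r => (L, false, r)
  | s + 1, L, r =>
    if φ.eval L.val then (L, true, r) else walkS φ d s (stepL φ L (readU d r).1) (readU d r).2

/-- `walkS` projects to `walk`. [folklore] -/
theorem walkS_snd (φ : KCNF k) (d : ℕ) : ∀ (s : ℕ) (L : Asg) (r : List Bool),
    (walkS φ d s L r).2 = walk φ d s L r
  | 0, L, r => rfl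
  | s + 1, L, r => by
    unfold walkS walk
    split_ifs
    · rfl
    · exact walkS_snd φ d s _ _

/-- `walkS` on a satisfied list. [folklore] -/
theorem walkS_succ_of_eval {φ : KCNF k} {d s : ℕ} {L : Asg} {r : List Bool} (h : φ.eval L.val = true) :
    walkS φ d (s + 1) L r = (L, true, r) := by
  rw [walkS, if_pos h]

/-- `walkS` on an unsatisfied list. [folklore] -/
theorem walkS_succ_of_not_eval {φ : KCNF k} {d s : ℕ} {L : Asg} {r : List Bool} (h : φ.eval L.val = false) :
    walkS φ d (s + 1) L r = walkS φ d s (stepL φ L (readU d r).1) (readU d r).2 := by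
  rw [walkS]
  simp only [h, Bool.false_eq_true, ite_false]

/-! ### Length bookkeeping -/

/-- The code of a literal on a variable of the formula is at most as long as the formula word.
[folklore] -/
theorem length_encodeLiteral_le (φ : KCNF k) {c : List (ℕ × Bool)} (hc : c ∈ φ.clauses) {l : ℕ × Bool}
    (hl : l ∈ c) (b : Bool) : (KCNF.encodeLiteral (l.1, b)).length ≤ (formW φ).length := by
  have h1 : (KCNF.encodeLiteral (l.1, b)).length = (litW l).length := by simp [KCNF.encodeLiteral, litW]
  have h2 : (litW l).length ≤ (clauseW c).length := by
    have := Transcode.length_le_length_flatMap litW hl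
    simp only [clauseW, List.length_cons, List.length_append]
    omega
  have h3 : (clauseW c).length ≤ (formW φ).length := Transcode.length_le_length_flatMap clauseW hc
  omega

/-- One flip lengthens the assignment word by at most the formula length. [folklore] -/
theorem length_cbody_pickL_le (φ : KCNF k) (L : List Lit) {C : List (ℕ × Bool)} (hC : C ∈ φ.clauses) (u : ℕ) :
    (cbody (pickL L C u)).length ≤ (cbody L).length + (formW φ).length := by
  unfold pickL
  split_ifs with h
  · rw [cbody_cons]
    have := length_encodeLiteral_le φ hC (List.get_mem C ⟨u, h⟩) (!Asg.val L (C.get ⟨u, h⟩).1)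
    simp only [KCNF.encodeLiteral, List.length_cons, List.length_append, List.length_map] at this
    simp only [List.length_append, List.length_cons, Sparsifier.litBody, List.length_map]
    omega
  · omega

/-- One step lengthens the assignment word by at most the formula length. [folklore] -/
theorem length_cbody_stepL_le (φ : KCNF k) (L : List Lit) (u : ℕ) :
    (cbody (stepL φ L u)).length ≤ (cbody L).length + (formW φ).length := by
  cases hv : viol φ (Asg.val L) with
  | none => unfold stepL; rw [hv]; simp
  | some C => rw [stepL_eq_pickL φ L u hv]; exact length_cbody_pickL_le φ L (viol_eq_some hv).1 u

/-- The staging of a clause of the formula is at most twice as long as the formula word. [folklore] -/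
theorem length_stagedW_le (φ : KCNF k) (L : List Lit) {C : List (ℕ × Bool)} (hC : C ∈ φ.clauses) :
    (wEntries Γ'.blank (C.map (entryW L))).length ≤ 2 * (formW φ).length := by
  have h1 : ∀ c' : List (ℕ × Bool), (wEntries Γ'.blank (c'.map (entryW L))).length ≤ 2 * (c'.flatMap litW).length := by
    intro c'
    induction c' with
    | nil => simp [wEntries]
    | cons l c' ih =>
      rw [List.map_cons, wEntries_cons, List.flatMap_cons]
      simp only [List.length_append, List.length_cons] at ih ⊢
      have : (entryW L l).length + 1 ≤ 2 * (litW l).length := by simp [entryW, litW, rbits]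
      omega
  have h2 : (C.flatMap litW).length ≤ (clauseW C).length := by simp [clauseW]; omega
  have h3 : (clauseW C).length ≤ (formW φ).length := Transcode.length_le_length_flatMap clauseW hC
  have := h1 C
  omega

/-- The initial literal list: one literal per occurrence, so its word is at most as long as the
formula word. [folklore] -/
theorem length_cbody_initL_le (φ : KCNF k) (cs : List Bool) :
    (cbody (initL (occs φ) [] cs).1).length ≤ (formW φ).length := by
  have key : ∀ (cls : List (List (ℕ × Bool))) (L : Asg) (cs : List Bool),
      (cbody (initL (cls.flatMap fun c => c.map Prod.fst) L cs).1).length ≤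
        (cbody L).length + (cls.flatMap clauseW).length := by
    intro cls
    induction cls with
    | nil => intro L cs; simp [initL]
    | cons c cls ih =>
      intro L cs
      rw [List.flatMap_cons, initL_append_occs, List.flatMap_cons, List.length_append]
      refine (ih _ _).trans ?_
      have hc : ∀ (c' : List (ℕ × Bool)) (L' : Asg) (cs' : List Bool),
          (cbody (initL (c'.map Prod.fst) L' cs').1).length ≤ (cbody L').length + (c'.flatMap litW).length := by
        intro c'
        induction c' with
        | nil => intro L' cs'; simp [initL]
        | cons l c' ihc =>
          intro L' cs'
          rw [List.map_cons, initL, List.flatMap_cons, List.length_append]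
          refine (ihc _ _).trans ?_
          simp [cbody_cons, Sparsifier.litBody, litW]
          omega
      have := hc c L cs
      simp only [clauseW, List.length_cons, List.length_append]
      omega
  have := key φ.clauses [] cs
  simpa [formW, occs] using this

/-! ### Reading coins, for leaves specified on one store shape -/

/-- **`coinTree`, with the leaves specified on the stores actually reached** (the tree only pops
`inp`): if every leaf `f u` runs from `st {ρ with inp := coins}` to `st (F u coins)` within `C`,
the tree runs the leaf of `(readU d cs).1` on the remaining coins. [folklore] -/
theorem runs_coinTree' (C : ℕ) : ∀ (d : ℕ) (f : ℕ → RProg) (ρ : MSt) (F : ℕ → List Bool → MSt),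
    (∀ u < 2 ^ d, ∀ cs : List Bool, Runs (f u) (st { ρ with inp := cs.map Γ'.bit }) (st (F u cs)) C) →
    ∀ cs : List Bool,
      Runs (coinTree d f) (st { ρ with inp := cs.map Γ'.bit })
        (st (F (readU d cs).1 (readU d cs).2)) (2 * d + C)
  | 0, f, ρ, F, hf, cs => by simpa [coinTree, readU] using hf 0 (by simp) cs
  | d + 1, f, ρ, F, hf, cs => by
    unfold coinTree
    rw [show 2 * (d + 1) + C = (2 * d + C) + 2 by ring]
    have hf0 : ∀ u < 2 ^ d, ∀ cs : List Bool,
        Runs (f (2 * u)) (st { ρ with inp := cs.map Γ'.bit }) (st (F (2 * u) cs)) C :=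
      fun u hu cs => hf _ (by rw [pow_succ]; omega) cs
    have hf1 : ∀ u < 2 ^ d, ∀ cs : List Bool,
        Runs (f (1 + 2 * u)) (st { ρ with inp := cs.map Γ'.bit }) (st (F (1 + 2 * u) cs)) C :=
      fun u hu cs => hf _ (by rw [pow_succ]; omega) cs
    cases cs with
    | nil =>
      have ih := runs_coinTree' C d (fun u => f (2 * u)) ρ (fun u => F (2 * u)) hf0 []
      refine Runs.pop_nil (by simp) ?_
      simpa [readU, popD] using ih
    | cons b cs =>
      cases b with
      | true =>
        have ih := runs_coinTree' C d (fun u => f (1 + 2 * u)) ρ (fun u => F (1 + 2 * u)) hf1 cs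
        refine Runs.pop_cons
          (show st { ρ with inp := (true :: cs).map Γ'.bit } (kr KR.inp) = Γ'.bit true :: cs.map Γ'.bit by simp) ?_
        simpa [readU, popD] using ih
      | false =>
        have ih := runs_coinTree' C d (fun u => f (2 * u)) ρ (fun u => F (2 * u)) hf0 cs
        refine Runs.pop_cons
          (show st { ρ with inp := (false :: cs).map Γ'.bit } (kr KR.inp) = Γ'.bit false :: cs.map Γ'.bit by simp) ?_
        simpa [readU, popD] using ih

/-! ### One step of the walk -/

/-- The core of a step: scan; if no clause is violated raise `done`, otherwise read `dOf k` coins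
and flip the chosen literal of the staged clause. [cite: SchoeningFOCS1999, Theorem (the algorithm: one step of the inner loop)] -/
def stepCore (k : ℕ) : RProg :=
  scan ;; pop (kr KR.fl) fun o => match o with
    | none => push (kr KR.done) Γ'.blank
    | some _ => coinTree (dOf k) (pick k)

/-- One step of the walk: nothing once `done` is up. [folklore] -/
def step (k : ℕ) : RProg :=
  ifTop (kr KR.done) fun o => match o with
    | some _ => skip
    | none => stepCore k

/-- The budget of one step (formula word of length `W`, assignment word of length `≤ V`). [folklore] -/
def stepCost (k W V : ℕ) : ℕ :=
  scanCost W V + 2 * dOf k + ((12 * W + k + 7) * k + 6 * W + 6 * k + 2 * k + 5) + 7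

/-- `scanCost` is monotone in the assignment length. [folklore] -/
theorem scanCost_mono (W : ℕ) {V V' : ℕ} (h : V ≤ V') : scanCost W V ≤ scanCost W V' := by
  unfold scanCost
  have := Nat.mul_le_mul_left (12 * W + 46) h
  nlinarith

/-- The store shape of the walk: formula, assignment, coins, and all scratch registers of a step
empty. [folklore] -/
def walkSt (ρ : MSt) (fam vt inp done cy : List Γ') : MSt :=
  { ρ with
    fam := fam, vt := vt, inp := inp, done := done, cy := cy, fam2 := [], pr := [], val := [], res := [], clR := []
    cl := [], fl := [], iu := [], c := [], c2 := [], t1 := [], t2 := [] }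

/-- **A step from a satisfying assignment**: `done` is raised, nothing else changes.
[cite: SchoeningFOCS1999, Theorem (the algorithm: "if the assignment satisfies F then accept")] -/
theorem runs_step_sat (φ : KCNF k) (ρ : MSt) (L : List Lit) (cs : List Bool) (cy : List Γ') {V : ℕ}
    (hV : (cbody L).length ≤ V) (h : φ.eval (Asg.val L) = true) :
    Runs (step k) (st (walkSt ρ (formW φ) (cbody L) (cs.map Γ'.bit) [] cy))
      (st (walkSt ρ (formW φ) (cbody L) (cs.map Γ'.bit) [Γ'.blank] cy)) (stepCost k (formW φ).length V) := by
  unfold step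
  have h1 := runs_scan φ { ρ with inp := cs.map Γ'.bit, done := [], cy := cy, iu := [], c := [], c2 := [] } L
  rw [(eval_eq_true_iff_viol_eq_none φ _).1 h] at h1
  simp only [Option.isSome_none, Bool.false_eq_true, flagW_false _ not_false, stagedW] at h1
  have h2 := Runs.push (kr KR.done) Γ'.blank
    (st { ρ with
      inp := cs.map Γ'.bit, done := [], cy := cy, iu := [], c := [], c2 := [], fam := formW φ, fam2 := [], pr := []
      val := [], res := [], clR := [], vt := cbody L, t1 := [], t2 := [], fl := [], cl := [] })
  simp only [st_done, update_st_done] at h2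
  have inner : Runs (stepCore k) (st (walkSt ρ (formW φ) (cbody L) (cs.map Γ'.bit) [] cy))
      (st (walkSt ρ (formW φ) (cbody L) (cs.map Γ'.bit) [Γ'.blank] cy))
      (scanCost (formW φ).length (cbody L).length + (1 + 2)) := by
    unfold stepCore
    exact (h1.seq (Runs.pop_nil (st_fl _) h2)).of_eq rfl le_rfl
  refine (Runs.ifTop_nil (by simp [walkSt]) inner).mono ?_
  unfold stepCost
  have := scanCost_mono (formW φ).length hV
  omega

/-- **A step from a non-satisfying assignment**: `dOf k` coins are read and the walk moves to
`stepL φ L u`. [cite: SchoeningFOCS1999, Theorem (the algorithm: "choose a violated clause, flip a random literal of it")] -/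
theorem runs_step_unsat (hk : 1 ≤ k) (φ : KCNF k) (ρ : MSt) (L : List Lit) (cs : List Bool) (cy : List Γ') {V : ℕ}
    (hV : (cbody L).length ≤ V) (h : φ.eval (Asg.val L) = false) :
    Runs (step k) (st (walkSt ρ (formW φ) (cbody L) (cs.map Γ'.bit) [] cy))
      (st (walkSt ρ (formW φ) (cbody (stepL φ L (readU (dOf k) cs).1)) ((readU (dOf k) cs).2.map Γ'.bit) [] cy))
      (stepCost k (formW φ).length V) := by
  have hne : viol φ (Asg.val L) ≠ none := fun h' => by
    rw [← eval_eq_true_iff_viol_eq_none] at h'; rw [h'] at h; exact Bool.noConfusion h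
  obtain ⟨C, hC⟩ := Option.ne_none_iff_exists'.1 hne
  obtain ⟨hCφ, -⟩ := viol_eq_some hC
  have hCk : C.length ≤ k := φ.length_le C hCφ
  unfold step
  have h1 := runs_scan φ { ρ with inp := cs.map Γ'.bit, done := [], cy := cy, iu := [], c := [], c2 := [] } L
  rw [hC] at h1
  simp only [Option.isSome_some, stagedW] at h1
  rw [flagW_true _ trivial] at h1
  -- the leaves of the coin tree: `pick`
  have hleaf : ∀ (u : ℕ) (cs' : List Bool), Runs (pick k u)
      (st { ρ with
        inp := cs'.map Γ'.bit, done := [], cy := cy, iu := [], c := [], c2 := [], fam := formW φ, fam2 := [], pr := []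
        val := [], res := [], clR := [], vt := cbody L, t1 := [], t2 := [], fl := []
        cl := wEntries Γ'.blank (C.map (entryW L)) })
      (st { ρ with
        inp := cs'.map Γ'.bit, done := [], cy := cy, iu := [], c := [], c2 := [], fam := formW φ, fam2 := [], pr := []
        val := [], res := [], clR := [], vt := cbody (pickL L C u), t1 := [], t2 := [], fl := [], cl := [] })
      ((12 * (formW φ).length + k + 7) * k + 6 * (formW φ).length + 3 * u + 2 * k + 5) := by
    intro u cs'
    have hp := runs_pick k u
      { ρ with
        inp := cs'.map Γ'.bit, done := [], cy := cy, fam := formW φ, fam2 := [], pr := [], val := [], res := []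
        clR := [], t2 := [], fl := [], c2 := [] } L C hCk
    have hT := length_stagedW_le φ L hCφ
    refine hp.of_eq rfl ?_
    have h6 := Nat.mul_le_mul_right k (show 6 * (wEntries Γ'.blank (C.map (entryW L))).length + k + 7 ≤
      12 * (formW φ).length + k + 7 by omega)
    omega
  set ρ₁ : MSt := { ρ with
    done := [], cy := cy, iu := [], c := [], c2 := [], fam := formW φ, fam2 := [], pr := [], val := [], res := []
    clR := [], vt := cbody L, t1 := [], t2 := [], fl := [], cl := wEntries Γ'.blank (C.map (entryW L)) } with hρ₁
  have htree := runs_coinTree' ((12 * (formW φ).length + k + 7) * k + 6 * (formW φ).length + 6 * k + 2 * k + 5)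
    (dOf k) (pick k) ρ₁ (fun u cs' => { ρ₁ with inp := cs'.map Γ'.bit, vt := cbody (pickL L C u), cl := [] })
    (fun u hu cs' => by
      have h2k := two_pow_dOf_le hk
      have hl := (hleaf u cs').mono (show _ ≤ (12 * (formW φ).length + k + 7) * k + 6 * (formW φ).length +
        6 * k + 2 * k + 5 by omega)
      simpa only [hρ₁] using hl)
    cs
  rw [stepL_eq_pickL φ L _ hC]
  have inner : Runs (stepCore k) (st (walkSt ρ (formW φ) (cbody L) (cs.map Γ'.bit) [] cy))
      (st (walkSt ρ (formW φ) (cbody (pickL L C (readU (dOf k) cs).1)) ((readU (dOf k) cs).2.map Γ'.bit) [] cy))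
      (scanCost (formW φ).length (cbody L).length + ((2 * dOf k +
        ((12 * (formW φ).length + k + 7) * k + 6 * (formW φ).length + 6 * k + 2 * k + 5)) + 2)) := by
    unfold stepCore
    exact (h1.seq (Runs.pop_cons (st_fl _) (by simpa only [hρ₁, update_st_fl, walkSt] using htree))).of_eq rfl le_rfl
  refine (Runs.ifTop_nil (by simp [walkSt]) inner).mono ?_
  unfold stepCost
  have := scanCost_mono (formW φ).length hV
  omega


/-! ### The walk: the loop over the step counter -/

/-- Once `done` is up, the remaining ticks are consumed at `5` steps each. [folklore] -/
theorem runs_cyLoop_done (k : ℕ) (ρ : MSt) (fam vt inp : List Γ') (n : ℕ) :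
    Runs (loop (tb TB.cy) fun _ => step k) (st (walkSt ρ fam vt inp [Γ'.blank] (List.replicate n Γ'.blank)))
      (st (walkSt ρ fam vt inp [Γ'.blank] [])) (5 * n + 1) := by
  have h := runs_loop_inv (k := tb TB.cy) (f := fun _ => step k)
    (fun _ rest => st (walkSt ρ fam vt inp [Γ'.blank] rest)) (fun _ _ => True) 3
    (fun _ _ _ => by simp [walkSt]) (fun done a rest _ => ⟨trivial, by
      unfold step
      refine (Runs.ifTop_cons (x := Γ'.blank) (w := []) (by simp [walkSt]) (Runs.skip _)).of_eq ?_ (by omega)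
      simp [walkSt]⟩)
    (List.replicate n Γ'.blank) [] trivial
  simp only [List.length_replicate] at h
  exact h.of_eq rfl (by omega)

/-- **The walk loop**: `n` ticks on the counter run `n` steps of the walk (`walkS`), provided the
assignment word stays within the length `V` used in the step budget. [cite: SchoeningFOCS1999, Theorem (the algorithm: the inner loop of 3n steps)] -/
theorem runs_walkLoop (hk : 1 ≤ k) (φ : KCNF k) (ρ : MSt) (V : ℕ) : ∀ (n : ℕ) (L : List Lit) (cs : List Bool),
    (cbody L).length + n * (formW φ).length ≤ V →
    Runs (loop (tb TB.cy) fun _ => step k)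
      (st (walkSt ρ (formW φ) (cbody L) (cs.map Γ'.bit) [] (List.replicate n Γ'.blank)))
      (st (walkSt ρ (formW φ) (cbody (walkS φ (dOf k) n L cs).1) ((walkS φ (dOf k) n L cs).2.2.map Γ'.bit)
        (flagW Γ'.blank ((walkS φ (dOf k) n L cs).2.1 = true)) []))
      (n * (stepCost k (formW φ).length V + 2) + 1)
  | 0, L, cs, _ => by
    simpa [walkS] using Runs.loop_nil (fun _ => step k) (R := st (walkSt ρ (formW φ) (cbody L) (cs.map Γ'.bit) [] []))
      (by simp [walkSt])
  | n + 1, L, cs, hV => by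
    have hL : (cbody L).length ≤ V := le_trans (Nat.le_add_right _ _) hV
    by_cases h : φ.eval (Asg.val L) = true
    · rw [walkS_succ_of_eval h]
      have h1 := runs_step_sat (k := k) φ ρ L cs (List.replicate n Γ'.blank) hL h
      have h2 := runs_cyLoop_done k ρ (formW φ) (cbody L) (cs.map Γ'.bit) n
      refine (Runs.loop_cons (a := Γ'.blank) (w := List.replicate n Γ'.blank)
        (by simp [walkSt, List.replicate_succ]) (by simpa [walkSt] using h1) h2).of_eq (by simp) ?_
      have : 5 ≤ stepCost k (formW φ).length V + 2 := by unfold stepCost; omega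
      rw [Nat.succ_mul]
      nlinarith
    · rw [Bool.not_eq_true] at h
      rw [walkS_succ_of_not_eval h]
      have h1 := runs_step_unsat hk φ ρ L cs (List.replicate n Γ'.blank) hL h
      have hV' : (cbody (stepL φ L (readU (dOf k) cs).1)).length + n * (formW φ).length ≤ V := by
        have := length_cbody_stepL_le φ L (readU (dOf k) cs).1
        rw [Nat.succ_mul] at hV
        omega
      have h2 := runs_walkLoop hk φ ρ V n (stepL φ L (readU (dOf k) cs).1) (readU (dOf k) cs).2 hV'
      refine (Runs.loop_cons (a := Γ'.blank) (w := List.replicate n Γ'.blank)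
        (by simp [walkSt, List.replicate_succ]) (by simpa [walkSt] using h1) h2).of_eq rfl ?_
      rw [Nat.succ_mul]
      omega

/-! ### One restart -/

/-- The core of a restart: clear the assignment, lay a fresh random one, lay the step counter, walk.
[cite: SchoeningFOCS1999, Theorem (the algorithm: one iteration of the outer loop)] -/
def restartCore (k : ℕ) : RProg :=
  clear (tb TB.vt) ;; initPass ;; mkCy k ;; loop (tb TB.cy) fun _ => step k

/-- One restart (the program; `restart` is the coin-string function): nothing once `done` is up.
[folklore] -/
def restartP (k : ℕ) : RProg :=
  ifTop (kr KR.done) fun o => match o with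
    | some _ => skip
    | none => restartCore k

/-- The restart of `SchoeningCoinAlgorithm.lean` with its final literal list. [folklore] -/
def restartS (φ : KCNF k) (d S : ℕ) (cs : List Bool) : Asg × Bool × List Bool :=
  walkS φ d S (initL (occs φ) [] cs).1 (initL (occs φ) [] cs).2

/-- `restartS` projects to `restart`. [folklore] -/
theorem restartS_snd (φ : KCNF k) (d S : ℕ) (cs : List Bool) :
    (restartS φ d S cs).2 = restart φ d S cs := by
  unfold restartS restart; rw [walkS_snd]

/-- The budget of one restart (formula word of length `W`, `S` steps, old assignment word of
length `v`). [folklore] -/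
def restartCost (k W S v : ℕ) : ℕ :=
  2 * v + (19 * W + 4) + ((2 * k + 12) * W + 5) + (S * (stepCost k W ((S + 1) * W) + 2) + 1) + 3

/-- `restartCost` is monotone in the old assignment length. [folklore] -/
theorem restartCost_mono (k W S : ℕ) {v v' : ℕ} (h : v ≤ v') : restartCost k W S v ≤ restartCost k W S v' := by
  unfold restartCost; omega

/-- **Specification of `restart`** (flag `done` down): the assignment register ends with the final
literal list of `restartS`, the coins consumed leave `inp`, and `done` records the success.
[cite: SchoeningFOCS1999, Theorem (the algorithm: one iteration of the outer loop)] -/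
theorem runs_restart (hk : 1 ≤ k) (φ : KCNF k) (ρ : MSt) (vt₀ : List Γ') (cs : List Bool) :
    Runs (restartP k) (st (walkSt ρ (formW φ) vt₀ (cs.map Γ'.bit) [] []))
      (st (walkSt ρ (formW φ) (cbody (restartS φ (dOf k) (sOf φ) cs).1)
        ((restartS φ (dOf k) (sOf φ) cs).2.2.map Γ'.bit)
        (flagW Γ'.blank ((restartS φ (dOf k) (sOf φ) cs).2.1 = true)) []))
      (restartCost k (formW φ).length (sOf φ) vt₀.length) := by
  unfold restartP
  rw [show restartCost k (formW φ).length (sOf φ) vt₀.length =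
    (restartCost k (formW φ).length (sOf φ) vt₀.length - 2) + 2 by unfold restartCost; omega]
  refine Runs.ifTop_nil (by simp [walkSt]) ?_
  unfold restartCore
  -- clear the old assignment
  have h1 := runs_clear (tb TB.vt) (st (walkSt ρ (formW φ) vt₀ (cs.map Γ'.bit) [] []))
  simp only [walkSt, st_vt, update_st_vt] at h1
  -- the random initial assignment
  have h2 := runs_initPass φ
    { ρ with
      fam := formW φ, vt := [], inp := cs.map Γ'.bit, done := [], cy := [], fam2 := [], pr := [], val := [], res := []
      clR := [], cl := [], fl := [], iu := [], c := [], c2 := [], t1 := [], t2 := [] }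
    cs rfl rfl rfl rfl rfl rfl rfl
  -- the step counter
  have h3 := runs_mkCy k
    { ρ with
      fam := formW φ, vt := cbody (initL (occs φ) [] cs).1, inp := (initL (occs φ) [] cs).2.map Γ'.bit, done := []
      cy := [], fam2 := [], pr := [], val := [], res := [], clR := [], cl := [], fl := [], iu := [], c := [], c2 := []
      t1 := [], t2 := [] }
    rfl rfl rfl rfl
  simp only [count_comma_formW] at h3
  rw [show 2 * k * (occs φ).length + 1 = sOf φ from rfl] at h3
  -- the walk
  have h4 := runs_walkLoop hk φ ρ ((sOf φ + 1) * (formW φ).length) (sOf φ) (initL (occs φ) [] cs).1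
    (initL (occs φ) [] cs).2 (by
      have := length_cbody_initL_le φ cs
      rw [Nat.succ_mul]; omega)
  unfold restartS
  refine (h1.seq (h2.seq (h3.seq (by simpa only [walkSt] using h4)))).of_eq rfl ?_
  unfold restartCost
  omega

/-- **A restart once `done` is up**: nothing happens (`3` steps). [folklore] -/
theorem runs_restart_done (k : ℕ) (ρ : MSt) (fam vt inp : List Γ') :
    Runs (restartP k) (st (walkSt ρ fam vt inp [Γ'.blank] [])) (st (walkSt ρ fam vt inp [Γ'.blank] [])) 3 := by
  unfold restartP
  exact (Runs.ifTop_cons (x := Γ'.blank) (w := []) (by simp [walkSt]) (Runs.skip _)).of_eq rfl (by omega)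

/-- The assignment word after a restart is bounded by `(S + 1) W`. [folklore] -/
theorem length_cbody_restartS_le (φ : KCNF k) (d : ℕ) (cs : List Bool) :
    (cbody (restartS φ d (sOf φ) cs).1).length ≤ (sOf φ + 1) * (formW φ).length := by
  have key : ∀ (n : ℕ) (L : Asg) (r : List Bool),
      (cbody (walkS φ d n L r).1).length ≤ (cbody L).length + n * (formW φ).length := by
    intro n
    induction n with
    | zero => intro L r; simp [walkS]
    | succ n ih =>
      intro L r
      by_cases h : φ.eval L.val = true
      · rw [walkS_succ_of_eval h]; simp
      · rw [Bool.not_eq_true] at h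
        rw [walkS_succ_of_not_eval h]
        refine (ih _ _).trans ?_
        have := length_cbody_stepL_le φ L (readU d r).1
        rw [Nat.succ_mul]; omega
  unfold restartS
  refine (key _ _ _).trans ?_
  have := length_cbody_initL_le φ cs
  rw [Nat.succ_mul]; omega

end Literature.Computability.FineGrained.SchoeningCoin
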